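/-
Origin: expansion seat `planner-pub-hodgecm-pv06-0`, handover (7) 2026-08-18T04:12:48Z (`HOME/pub-hodgecm-pv06/lean/Pv06/PerL34/ArchCGen.lean`, md5 35080abe, 40 lines);
landed by the gen-5 packager in gate run 21 as `HodgeCM/PerL34/ArchCGen.lean` (verbatim).
-/
/-
  pub-hodgecm — DAG edge N28 → N29 BY NAME (carver LEMMAS v4 §9 seam S4), pv06:
  the `[NODE N28]` field `gen` of pv06's landed `HodgeCM.PerL34.ArchC.ArchCDatum` IS, definitionally,
  pv12's predicate `HodgeCM.PerL34.Fock.IsGeneratedBy A.X A.φ₀` (`ArchBGen.lean`, run-20 intake), so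
  pv12's `N28_gen_kernel` / `isGeneratedBy_tmul` / `isGeneratedBy_E|M|I` feed `ArchCDatum.gen` with no
  further glue once the model takes `F = ⊗_b kappaPart_b` (Dictionary D5, GAPS pv12/N28 — the only residual).
  Imports the landed `HodgeCM.PerL34.ArchC` (run 18) and `HodgeCM.PerL34.ArchBGen` (run-20 intake).
  Nothing posited; both directions are `Iff.rfl`.
-/
import Summits.HodgeConjecture.HodgeCM.PerL34.ArchC_2
import Summits.HodgeConjecture.HodgeCM.PerL34.ArchBGen

/-! PORT of `HodgeCM/PerL34/ArchCGen.lean` (HodgeCMPerL run 82) — verbatim mechanical port; provenance in the PORT header line. -/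

noncomputable section

namespace HodgeCM.PerL34.ArchC

open HodgeCM.Prior.Perl34File HodgeCM.Prior.Perl34File.Perl34

/-- pv12's predicate unfolds to the field type of `ArchCDatum.gen`. -/
theorem isGeneratedBy_iff {F : Type*} [AddCommGroup F] [Module ℂ F] {ι : Type*}
    (X : ι → F →ₗ[ℂ] F) (φ₀ : F) :
    Fock.IsGeneratedBy X φ₀ ↔
      ∀ N : Submodule ℂ F, φ₀ ∈ N → (∀ k, ∀ φ ∈ N, X k φ ∈ N) → N = ⊤ :=
  Iff.rfl

variable {H HG CG G SK SigIdx SigIdxG : Type*}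
variable [NormedAddCommGroup H] [InnerProductSpace ℂ H] [CompleteSpace H]
variable [NormedAddCommGroup HG] [InnerProductSpace ℂ HG] [CompleteSpace HG]
variable [NormedAddCommGroup CG] [NormedSpace ℂ CG]
variable [Group G] [TopologicalSpace G] [TopologicalSpace SK]
variable {C : IsolationCore H HG CG G SK SigIdx SigIdxG} {D : TorusData C} {P : C4a.PointedCore C}

/-- Seam S4, producer side read back: an `ArchCDatum`'s `gen` field is pv12's `IsGeneratedBy`. -/
theorem ArchCDatum.isGeneratedBy (A : ArchCDatum C D P) :
    Fock.IsGeneratedBy A.X A.φ₀ :=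
  A.gen

end HodgeCM.PerL34.ArchC

end
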